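import Summits.BirchSwinnertonDyer.Rank1Residual.X9.PrintCertTamagawaCertsX10b
import Summits.BirchSwinnertonDyer.Rank1Residual.X9.PrintCertRecordsX10bNn
import Summits.BirchSwinnertonDyer.Rank1Residual.X9.PrintCertRecordsX10bNsR0A
import Summits.BirchSwinnertonDyer.Rank1Residual.X9.PrintCertRecordsX10bNsR0B
import Summits.BirchSwinnertonDyer.Rank1Residual.X9.PrintCertRecordsX10bNsR1
import HarnessLib

/-!
# The Tamagawa certificates PASS IN THE KERNEL — leaf X10b, `p = 3`: display theorems, J-regime census

Group: leaf X10b (`p = 3`, images `3Nn` / `3Ns`; slices `X10bNn`, `X10bNsR0A`, `X10bNsR0B`, `X10bNsR1`: 313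
records). HONEST FRAMING (cell `bsd-print-x9`, D-0131 (2) print tier): theorems only; no named fact; nothing
asserted about any elliptic curve beyond what the kernel rechecks; no pair is booked and no leaf is closed
(`BSDpOnClassX9`, `BSDpOnClassX10b` stay `@[conjecture]`). For each slice: `tamWalk_<Slice>` — every record's
Tamagawa row certificate (`X9/PrintCertTamagawaCertsX10b.lean`) passes `Record.tamCheck`
(`X9/PrintCertTamagawa.lean`) on the record's integral model, by `decide +kernel`; hence for ANY globally minimal `W
/ ℚ` with `integralModelInt W = r.intCurve` (`W = r.curve`, `hI = r.integralModelInt_curve` for the record's own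
model): `tamagawaProduct_of_mem_<Slice>` (`∏_ℓ c_ℓ(W) = r.tamagawa`), `not_dvd_tamagawaProduct_of_mem_<Slice>`
(J-VACUOUS pairs: `¬ p ∣ ∏ c_ℓ`, the `htam0` binder of
`pPartBSD_of_classX9_of_not_dvd_tamagawa_of_integralMainConjectureOnClassX9`), `exists_carrier_of_mem_<Slice>`
(SINGLE-CARRIER pairs: the literal hypothesis of the BC3 case split `HeegnerDivisibilityX9_of` of crux J, item
20392), and `exists_tamCheck_of_mem_<Slice>` (the certificate itself, for
`Record.localTamagawaNumber_eq_of_tamCheck_of_mem_bad`: `c(W/ℚ_[q]) = c_q` at every listed prime). Kernel census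
`regime_<Slice>`: group totals 313 records = J-vacuous 160 + single-carrier 92 + multi-prime 61; `jScreen_<Slice>`:
on every J-LIVE record every Heegner triple of record `(D, m, v_p(m))` has `ord_p ∏ c_ℓ ≤ v_p(m)` (0 triples; a
DATA-level necessary condition of J — `p^t ∣ [E(K):ℤy_K]` — read on the fold's Heegner indices, not a theorem about
curves).
-/

namespace Summit.BirchSwinnertonDyer.Rank1Residual.X9.PrintCert

open WeierstrassCurve Summit.BirchSwinnertonDyer.BirchSwinnertonDyer.Rank2Observatory.Tam

-- `decide +kernel` runs Tate's algorithm certificates and trial division on every record: raise the recursion depth.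
set_option maxRecDepth 100000

/-! ### Slice `X10bNn` (84 records) -/

/-- **The 84 Tamagawa row certificates of slice `X10bNn` PASS IN THE KERNEL** against `recordsX10bNn` (Tate's
algorithm certificates on each record's integral model; all local values exact; kernel product = `tamagawa`, kernel
local values = `bad`). [cite: Silverman1994, IV.9.4] [cite: Tate1975, §7] -/
theorem tamWalk_X10bNn : tamWalk recordsX10bNn tamCertsX10bNn = true := by
  decide +kernel

/-- Every record of slice `X10bNn` has a passing Tamagawa certificate (feed it to
`Record.localTamagawaNumber_eq_of_tamCheck_of_mem_bad` / `Record.dvd_conductorNorm_of_tamCheck`). [cite: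
Silverman1994, IV.9.4] -/
theorem exists_tamCheck_of_mem_X10bNn {r : Record} (hr : r ∈ recordsX10bNn) : ∃ c ∈ tamCertsX10bNn, r.tamCheck c = true :=
  exists_tamCheck_of_tamWalk tamWalk_X10bNn r hr

/-- **`∏_ℓ c_ℓ(W) = r.tamagawa` IN THE KERNEL for every record of slice `X10bNn`** and any globally minimal `W / ℚ`
with the record's integral model. [cite: Silverman1994, IV.9.4] [cite: CremonaAlgorithms1997, Table 1] -/
theorem tamagawaProduct_of_mem_X10bNn {r : Record} (hr : r ∈ recordsX10bNn) {W : WeierstrassCurve ℚ}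
    [W.IsGloballyMinimal] (hI : integralModelInt W = r.intCurve) : W.tamagawaProduct = r.tamagawa :=
  tamagawaProduct_eq_of_tamWalk tamWalk_X10bNn hr hI

/-- **J-VACUOUS records of slice `X10bNn`** (`¬ p ∣ tamagawa`, decidable on the data; 72 of 84): `¬ p ∣ ∏_ℓ c_ℓ(W)`
IN THE KERNEL (free prime `q`, `hq : q = r.p`). [cite: Silverman1994, IV.9.4] -/
theorem not_dvd_tamagawaProduct_of_mem_X10bNn {r : Record} (hr : r ∈ recordsX10bNn) (hp : ¬ r.p ∣ r.tamagawa)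
    {W : WeierstrassCurve ℚ} [W.IsGloballyMinimal] (hI : integralModelInt W = r.intCurve) {q : ℕ} (hq : q = r.p) :
    ¬ q ∣ W.tamagawaProduct :=
  not_dvd_tamagawaProduct_of_tamWalk tamWalk_X10bNn hr hp hI hq

/-- **SINGLE-CARRIER records of slice `X10bNn`** (`singleCarrier = some q₀`; 12 of 84): there is a prime `q ∣ N(W)`
with `ord_p ∏_ℓ c_ℓ(W) ≤ ord_p c(W/ℚ_[q])` IN THE KERNEL — the single-prime hypothesis of
`HeegnerDivisibilityX9_of`. [cite: Jetchev2008, Thm. 1.1] [cite: Silverman1994, IV.9.4] -/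
theorem exists_carrier_of_mem_X10bNn {r : Record} (hr : r ∈ recordsX10bNn) {q₀ : ℕ} (hs : r.singleCarrier = some q₀)
    {W : WeierstrassCurve ℚ} [W.IsElliptic] [W.IsGloballyMinimal] (hI : integralModelInt W = r.intCurve) {p : ℕ}
    (hp : p = r.p) : ∃ (q : ℕ) (_ : Fact q.Prime), q ∣ W.conductorNorm ℤ ∧
      padicValNat p W.tamagawaProduct ≤ padicValNat p ((W.baseChange ℚ_[q]).localTamagawaNumber ℤ_[q]) :=
  exists_carrier_of_tamWalk tamWalk_X10bNn hr hs hI hp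

/-- KERNEL CENSUS of slice `X10bNn` by J-regime: 72 J-vacuous records (`¬ p ∣ tamagawa`), 12 with a single carrier,
0 in the multi-prime regime (`p ∣ tamagawa`, no carrier); maximal depth `ord_p ∏ c_ℓ` = 1. [folklore] -/
theorem regime_X10bNn :
    (recordsX10bNn.filter fun r => !decide (r.p ∣ r.tamagawa)).length = 72 ∧
    (recordsX10bNn.filter fun r => r.singleCarrier.isSome).length = 12 ∧
    (recordsX10bNn.filter fun r => decide (r.p ∣ r.tamagawa) && r.singleCarrier.isNone).length = 0 ∧
    (recordsX10bNn.map fun r => padicValNat r.p r.tamagawa).foldr max 0 = 1 := by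
  decide +kernel

/-- J-SCREEN of slice `X10bNn` (data level, 0 Heegner triples on J-live records): on every record with `p ∣
tamagawa`, every Heegner triple of record `(D, m, v)` has `ord_p tamagawa ≤ v` (`= v_p` of the fold's Heegner index
`m`; necessary for J since `y_K = P_1`). [folklore] -/
theorem jScreen_X10bNn : ∀ r ∈ recordsX10bNn, r.p ∣ r.tamagawa →
    ∀ h ∈ r.heegner, padicValNat r.p r.tamagawa ≤ h.2.2 := by
  decide +kernel

/-! ### Slice `X10bNsR0A` (95 records) -/

/-- **The 95 Tamagawa row certificates of slice `X10bNsR0A` PASS IN THE KERNEL** against `recordsX10bNsR0A` (Tate's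
algorithm certificates on each record's integral model; all local values exact; kernel product = `tamagawa`, kernel
local values = `bad`). [cite: Silverman1994, IV.9.4] [cite: Tate1975, §7] -/
theorem tamWalk_X10bNsR0A : tamWalk recordsX10bNsR0A tamCertsX10bNsR0A = true := by
  decide +kernel

/-- Every record of slice `X10bNsR0A` has a passing Tamagawa certificate (feed it to
`Record.localTamagawaNumber_eq_of_tamCheck_of_mem_bad` / `Record.dvd_conductorNorm_of_tamCheck`). [cite:
Silverman1994, IV.9.4] -/
theorem exists_tamCheck_of_mem_X10bNsR0A {r : Record} (hr : r ∈ recordsX10bNsR0A) : ∃ c ∈ tamCertsX10bNsR0A, r.tamCheck c = true :=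
  exists_tamCheck_of_tamWalk tamWalk_X10bNsR0A r hr

/-- **`∏_ℓ c_ℓ(W) = r.tamagawa` IN THE KERNEL for every record of slice `X10bNsR0A`** and any globally minimal `W /
ℚ` with the record's integral model. [cite: Silverman1994, IV.9.4] [cite: CremonaAlgorithms1997, Table 1] -/
theorem tamagawaProduct_of_mem_X10bNsR0A {r : Record} (hr : r ∈ recordsX10bNsR0A) {W : WeierstrassCurve ℚ}
    [W.IsGloballyMinimal] (hI : integralModelInt W = r.intCurve) : W.tamagawaProduct = r.tamagawa :=
  tamagawaProduct_eq_of_tamWalk tamWalk_X10bNsR0A hr hI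

/-- **J-VACUOUS records of slice `X10bNsR0A`** (`¬ p ∣ tamagawa`, decidable on the data; 45 of 95): `¬ p ∣ ∏_ℓ
c_ℓ(W)` IN THE KERNEL (free prime `q`, `hq : q = r.p`). [cite: Silverman1994, IV.9.4] -/
theorem not_dvd_tamagawaProduct_of_mem_X10bNsR0A {r : Record} (hr : r ∈ recordsX10bNsR0A) (hp : ¬ r.p ∣ r.tamagawa)
    {W : WeierstrassCurve ℚ} [W.IsGloballyMinimal] (hI : integralModelInt W = r.intCurve) {q : ℕ} (hq : q = r.p) :
    ¬ q ∣ W.tamagawaProduct :=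
  not_dvd_tamagawaProduct_of_tamWalk tamWalk_X10bNsR0A hr hp hI hq

/-- **SINGLE-CARRIER records of slice `X10bNsR0A`** (`singleCarrier = some q₀`; 41 of 95): there is a prime `q ∣
N(W)` with `ord_p ∏_ℓ c_ℓ(W) ≤ ord_p c(W/ℚ_[q])` IN THE KERNEL — the single-prime hypothesis of
`HeegnerDivisibilityX9_of`. [cite: Jetchev2008, Thm. 1.1] [cite: Silverman1994, IV.9.4] -/
theorem exists_carrier_of_mem_X10bNsR0A {r : Record} (hr : r ∈ recordsX10bNsR0A) {q₀ : ℕ} (hs : r.singleCarrier = some q₀)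
    {W : WeierstrassCurve ℚ} [W.IsElliptic] [W.IsGloballyMinimal] (hI : integralModelInt W = r.intCurve) {p : ℕ}
    (hp : p = r.p) : ∃ (q : ℕ) (_ : Fact q.Prime), q ∣ W.conductorNorm ℤ ∧
      padicValNat p W.tamagawaProduct ≤ padicValNat p ((W.baseChange ℚ_[q]).localTamagawaNumber ℤ_[q]) :=
  exists_carrier_of_tamWalk tamWalk_X10bNsR0A hr hs hI hp

/-- KERNEL CENSUS of slice `X10bNsR0A` by J-regime: 45 J-vacuous records (`¬ p ∣ tamagawa`), 41 with a single
carrier, 9 in the multi-prime regime (`p ∣ tamagawa`, no carrier); maximal depth `ord_p ∏ c_ℓ` = 3. [folklore] -/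
theorem regime_X10bNsR0A :
    (recordsX10bNsR0A.filter fun r => !decide (r.p ∣ r.tamagawa)).length = 45 ∧
    (recordsX10bNsR0A.filter fun r => r.singleCarrier.isSome).length = 41 ∧
    (recordsX10bNsR0A.filter fun r => decide (r.p ∣ r.tamagawa) && r.singleCarrier.isNone).length = 9 ∧
    (recordsX10bNsR0A.map fun r => padicValNat r.p r.tamagawa).foldr max 0 = 3 := by
  decide +kernel

/-- J-SCREEN of slice `X10bNsR0A` (data level, 0 Heegner triples on J-live records): on every record with `p ∣
tamagawa`, every Heegner triple of record `(D, m, v)` has `ord_p tamagawa ≤ v` (`= v_p` of the fold's Heegner index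
`m`; necessary for J since `y_K = P_1`). [folklore] -/
theorem jScreen_X10bNsR0A : ∀ r ∈ recordsX10bNsR0A, r.p ∣ r.tamagawa →
    ∀ h ∈ r.heegner, padicValNat r.p r.tamagawa ≤ h.2.2 := by
  decide +kernel

/-! ### Slice `X10bNsR0B` (95 records) -/

/-- **The 95 Tamagawa row certificates of slice `X10bNsR0B` PASS IN THE KERNEL** against `recordsX10bNsR0B` (Tate's
algorithm certificates on each record's integral model; all local values exact; kernel product = `tamagawa`, kernel
local values = `bad`). [cite: Silverman1994, IV.9.4] [cite: Tate1975, §7] -/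
theorem tamWalk_X10bNsR0B : tamWalk recordsX10bNsR0B tamCertsX10bNsR0B = true := by
  decide +kernel

/-- Every record of slice `X10bNsR0B` has a passing Tamagawa certificate (feed it to
`Record.localTamagawaNumber_eq_of_tamCheck_of_mem_bad` / `Record.dvd_conductorNorm_of_tamCheck`). [cite:
Silverman1994, IV.9.4] -/
theorem exists_tamCheck_of_mem_X10bNsR0B {r : Record} (hr : r ∈ recordsX10bNsR0B) : ∃ c ∈ tamCertsX10bNsR0B, r.tamCheck c = true :=
  exists_tamCheck_of_tamWalk tamWalk_X10bNsR0B r hr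

/-- **`∏_ℓ c_ℓ(W) = r.tamagawa` IN THE KERNEL for every record of slice `X10bNsR0B`** and any globally minimal `W /
ℚ` with the record's integral model. [cite: Silverman1994, IV.9.4] [cite: CremonaAlgorithms1997, Table 1] -/
theorem tamagawaProduct_of_mem_X10bNsR0B {r : Record} (hr : r ∈ recordsX10bNsR0B) {W : WeierstrassCurve ℚ}
    [W.IsGloballyMinimal] (hI : integralModelInt W = r.intCurve) : W.tamagawaProduct = r.tamagawa :=
  tamagawaProduct_eq_of_tamWalk tamWalk_X10bNsR0B hr hI

/-- **J-VACUOUS records of slice `X10bNsR0B`** (`¬ p ∣ tamagawa`, decidable on the data; 43 of 95): `¬ p ∣ ∏_ℓ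
c_ℓ(W)` IN THE KERNEL (free prime `q`, `hq : q = r.p`). [cite: Silverman1994, IV.9.4] -/
theorem not_dvd_tamagawaProduct_of_mem_X10bNsR0B {r : Record} (hr : r ∈ recordsX10bNsR0B) (hp : ¬ r.p ∣ r.tamagawa)
    {W : WeierstrassCurve ℚ} [W.IsGloballyMinimal] (hI : integralModelInt W = r.intCurve) {q : ℕ} (hq : q = r.p) :
    ¬ q ∣ W.tamagawaProduct :=
  not_dvd_tamagawaProduct_of_tamWalk tamWalk_X10bNsR0B hr hp hI hq

/-- **SINGLE-CARRIER records of slice `X10bNsR0B`** (`singleCarrier = some q₀`; 39 of 95): there is a prime `q ∣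
N(W)` with `ord_p ∏_ℓ c_ℓ(W) ≤ ord_p c(W/ℚ_[q])` IN THE KERNEL — the single-prime hypothesis of
`HeegnerDivisibilityX9_of`. [cite: Jetchev2008, Thm. 1.1] [cite: Silverman1994, IV.9.4] -/
theorem exists_carrier_of_mem_X10bNsR0B {r : Record} (hr : r ∈ recordsX10bNsR0B) {q₀ : ℕ} (hs : r.singleCarrier = some q₀)
    {W : WeierstrassCurve ℚ} [W.IsElliptic] [W.IsGloballyMinimal] (hI : integralModelInt W = r.intCurve) {p : ℕ}
    (hp : p = r.p) : ∃ (q : ℕ) (_ : Fact q.Prime), q ∣ W.conductorNorm ℤ ∧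
      padicValNat p W.tamagawaProduct ≤ padicValNat p ((W.baseChange ℚ_[q]).localTamagawaNumber ℤ_[q]) :=
  exists_carrier_of_tamWalk tamWalk_X10bNsR0B hr hs hI hp

/-- KERNEL CENSUS of slice `X10bNsR0B` by J-regime: 43 J-vacuous records (`¬ p ∣ tamagawa`), 39 with a single
carrier, 13 in the multi-prime regime (`p ∣ tamagawa`, no carrier); maximal depth `ord_p ∏ c_ℓ` = 3. [folklore] -/
theorem regime_X10bNsR0B :
    (recordsX10bNsR0B.filter fun r => !decide (r.p ∣ r.tamagawa)).length = 43 ∧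
    (recordsX10bNsR0B.filter fun r => r.singleCarrier.isSome).length = 39 ∧
    (recordsX10bNsR0B.filter fun r => decide (r.p ∣ r.tamagawa) && r.singleCarrier.isNone).length = 13 ∧
    (recordsX10bNsR0B.map fun r => padicValNat r.p r.tamagawa).foldr max 0 = 3 := by
  decide +kernel

/-- J-SCREEN of slice `X10bNsR0B` (data level, 0 Heegner triples on J-live records): on every record with `p ∣
tamagawa`, every Heegner triple of record `(D, m, v)` has `ord_p tamagawa ≤ v` (`= v_p` of the fold's Heegner index
`m`; necessary for J since `y_K = P_1`). [folklore] -/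
theorem jScreen_X10bNsR0B : ∀ r ∈ recordsX10bNsR0B, r.p ∣ r.tamagawa →
    ∀ h ∈ r.heegner, padicValNat r.p r.tamagawa ≤ h.2.2 := by
  decide +kernel

/-! ### Slice `X10bNsR1` (39 records) -/

/-- **The 39 Tamagawa row certificates of slice `X10bNsR1` PASS IN THE KERNEL** against `recordsX10bNsR1` (Tate's
algorithm certificates on each record's integral model; all local values exact; kernel product = `tamagawa`, kernel
local values = `bad`). [cite: Silverman1994, IV.9.4] [cite: Tate1975, §7] -/
theorem tamWalk_X10bNsR1 : tamWalk recordsX10bNsR1 tamCertsX10bNsR1 = true := by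
  decide +kernel

/-- Every record of slice `X10bNsR1` has a passing Tamagawa certificate (feed it to
`Record.localTamagawaNumber_eq_of_tamCheck_of_mem_bad` / `Record.dvd_conductorNorm_of_tamCheck`). [cite:
Silverman1994, IV.9.4] -/
theorem exists_tamCheck_of_mem_X10bNsR1 {r : Record} (hr : r ∈ recordsX10bNsR1) : ∃ c ∈ tamCertsX10bNsR1, r.tamCheck c = true :=
  exists_tamCheck_of_tamWalk tamWalk_X10bNsR1 r hr

/-- **`∏_ℓ c_ℓ(W) = r.tamagawa` IN THE KERNEL for every record of slice `X10bNsR1`** and any globally minimal `W /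
ℚ` with the record's integral model. [cite: Silverman1994, IV.9.4] [cite: CremonaAlgorithms1997, Table 1] -/
theorem tamagawaProduct_of_mem_X10bNsR1 {r : Record} (hr : r ∈ recordsX10bNsR1) {W : WeierstrassCurve ℚ}
    [W.IsGloballyMinimal] (hI : integralModelInt W = r.intCurve) : W.tamagawaProduct = r.tamagawa :=
  tamagawaProduct_eq_of_tamWalk tamWalk_X10bNsR1 hr hI

/-- **J-VACUOUS records of slice `X10bNsR1`** (`¬ p ∣ tamagawa`, decidable on the data; 0 of 39): `¬ p ∣ ∏_ℓ c_ℓ(W)`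
IN THE KERNEL (free prime `q`, `hq : q = r.p`). [cite: Silverman1994, IV.9.4] -/
theorem not_dvd_tamagawaProduct_of_mem_X10bNsR1 {r : Record} (hr : r ∈ recordsX10bNsR1) (hp : ¬ r.p ∣ r.tamagawa)
    {W : WeierstrassCurve ℚ} [W.IsGloballyMinimal] (hI : integralModelInt W = r.intCurve) {q : ℕ} (hq : q = r.p) :
    ¬ q ∣ W.tamagawaProduct :=
  not_dvd_tamagawaProduct_of_tamWalk tamWalk_X10bNsR1 hr hp hI hq

/-- **SINGLE-CARRIER records of slice `X10bNsR1`** (`singleCarrier = some q₀`; 0 of 39): there is a prime `q ∣ N(W)`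
with `ord_p ∏_ℓ c_ℓ(W) ≤ ord_p c(W/ℚ_[q])` IN THE KERNEL — the single-prime hypothesis of
`HeegnerDivisibilityX9_of`. [cite: Jetchev2008, Thm. 1.1] [cite: Silverman1994, IV.9.4] -/
theorem exists_carrier_of_mem_X10bNsR1 {r : Record} (hr : r ∈ recordsX10bNsR1) {q₀ : ℕ} (hs : r.singleCarrier = some q₀)
    {W : WeierstrassCurve ℚ} [W.IsElliptic] [W.IsGloballyMinimal] (hI : integralModelInt W = r.intCurve) {p : ℕ}
    (hp : p = r.p) : ∃ (q : ℕ) (_ : Fact q.Prime), q ∣ W.conductorNorm ℤ ∧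
      padicValNat p W.tamagawaProduct ≤ padicValNat p ((W.baseChange ℚ_[q]).localTamagawaNumber ℤ_[q]) :=
  exists_carrier_of_tamWalk tamWalk_X10bNsR1 hr hs hI hp

/-- KERNEL CENSUS of slice `X10bNsR1` by J-regime: 0 J-vacuous records (`¬ p ∣ tamagawa`), 0 with a single carrier,
39 in the multi-prime regime (`p ∣ tamagawa`, no carrier); maximal depth `ord_p ∏ c_ℓ` = 4. [folklore] -/
theorem regime_X10bNsR1 :
    (recordsX10bNsR1.filter fun r => !decide (r.p ∣ r.tamagawa)).length = 0 ∧
    (recordsX10bNsR1.filter fun r => r.singleCarrier.isSome).length = 0 ∧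
    (recordsX10bNsR1.filter fun r => decide (r.p ∣ r.tamagawa) && r.singleCarrier.isNone).length = 39 ∧
    (recordsX10bNsR1.map fun r => padicValNat r.p r.tamagawa).foldr max 0 = 4 := by
  decide +kernel

/-- J-SCREEN of slice `X10bNsR1` (data level, 0 Heegner triples on J-live records): on every record with `p ∣
tamagawa`, every Heegner triple of record `(D, m, v)` has `ord_p tamagawa ≤ v` (`= v_p` of the fold's Heegner index
`m`; necessary for J since `y_K = P_1`). [folklore] -/
theorem jScreen_X10bNsR1 : ∀ r ∈ recordsX10bNsR1, r.p ∣ r.tamagawa →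
    ∀ h ∈ r.heegner, padicValNat r.p r.tamagawa ≤ h.2.2 := by
  decide +kernel

end Summit.BirchSwinnertonDyer.Rank1Residual.X9.PrintCert
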